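import Literature.Probability.RandomPlanarGeometry.HexSAWPolygonCellsRoofEnd
import HarnessLib

/-!
# Cell calculus for honeycomb polygon surgery, IX: flip and leaf at ANY top-row hexagon — the RU-family bases (`j ≥ 1`)

Topic `Literature/Probability/RandomPlanarGeometry` (lane «pcv-sawmu», a-p4 g21; sequel of `HexSAWPolygonCellsRoofEnd.lean`).

The RU-family of the step-two injection «OMEGA» (`HOME/pub-sawmu-a-p4/g21/omega/THEOREM-OMEGA-g21.md` §2) acts, for the roof-end base
`B = B₀ + a_{k−1}`, at the hexagon `c_j = L^{2j} t₀` of the top row of `B₀`: a FLIP `B + UL c_j` when `L c_j ∈ B₀`, a LEAF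
`B₀ ∪ roof t₀ k ∪ {UL c_j}` when `L c_j ∉ B₀` (`j = 0` is part V).  The perimeter count needs only that `c_j` lies on the top row:
* `card_contacts_ul_topRow_two` — for a top-row hexagon `c` of `S` with `L c ∈ S`, `UL c` has exactly the contacts `L c`, `c` in `S`, also
  after adding hexagons on the top row right of the top hexagon (the roof) — so the flip is `+2` (`perim_chainFlip`);
* `card_contacts_ul_topRow_one` — with `L c ∉ S`, `UL c` has the single contact `c` — so the leaf costs `+4` and, after the roof fill of part II
  (`−2` against `B`), the leaf image is `+2` (`perim_chainLeaf`).

Sources: N. Madras, G. Slade, *The Self-Avoiding Walk* (1993), §3.2, proof of Theorem 3.2.3 [MadrasSlade1993]; I. Jensen, J. Phys.: Conf.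
Ser. 42 (2006) 163 [Jensen2006HoneycombPolygons].  Label (lane): LANE INFRASTRUCTURE; nothing new in writing.
-/

open Finset

namespace Literature.Probability.RandomPlanarGeometry.SAW

namespace HexCell

/-- Contacts of `UL c` for a top-row hexagon `c` in a set all of whose hexagons lie on rows `≤ c.y`: they are among `L c`, `c`.
[cite: MadrasSlade1993, §3.2 (proof of Theorem 3.2.3)] -/
theorem contacts_ul_subset_of_rows_le {W : Finset Cell} {c : Cell} (hW : ∀ d ∈ W, d.2 ≤ c.2) :
    nbrs (UL c) ∩ W ⊆ {L c, c} := by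
  obtain ⟨a, b⟩ := c
  intro d hd
  obtain ⟨hd, hdW⟩ := mem_inter.1 hd
  have hrow := hW d hdW
  simp only [mem_nbrs_iff, UL_fst, UL_snd] at hd
  simp only [mem_insert, mem_singleton]
  rcases hd with rfl | rfl | rfl | rfl | rfl | rfl
  · left; ext <;> simp; ring
  · right; ext <;> simp
  all_goals simp at hrow

/-- ★ **Flip at any top-row hexagon**: if every hexagon of `W` lies on rows `≤ c.y`, `c ∈ W` and `L c ∈ W`, then `UL c ∉ W` and `UL c` has
exactly two contacts. [cite: MadrasSlade1993, §3.2 (proof of Theorem 3.2.3: the unit surgery above a horizontal bond)] -/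
theorem card_contacts_ul_topRow_two {W : Finset Cell} {c : Cell} (hW : ∀ d ∈ W, d.2 ≤ c.2) (hc : c ∈ W) (hL : L c ∈ W) :
    UL c ∉ W ∧ #(nbrs (UL c) ∩ W) = 2 := by
  refine ⟨fun h => by have := hW _ h; simp at this, ?_⟩
  have e : nbrs (UL c) ∩ W = {L c, c} := by
    refine Subset.antisymm (contacts_ul_subset_of_rows_le hW) ?_
    intro d hd
    simp only [mem_insert, mem_singleton] at hd
    obtain ⟨a, b⟩ := c
    rcases hd with rfl | rfl
    · exact mem_inter.2 ⟨mem_nbrs_iff.2 (Or.inl (by ext <;> simp [L, UL]; ring)), hL⟩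
    · exact mem_inter.2 ⟨by simp [mem_nbrs_iff, UL], hc⟩
  rw [e, card_insert_of_notMem, card_singleton]
  obtain ⟨a, b⟩ := c
  simp [L]

/-- ★ **Leaf at any top-row hexagon**: if every hexagon of `W` lies on rows `≤ c.y`, `c ∈ W` and `L c ∉ W`, then `UL c ∉ W` and `UL c` has
exactly one contact. [cite: MadrasSlade1993, §3.2 (proof of Theorem 3.2.3)] -/
theorem card_contacts_ul_topRow_one {W : Finset Cell} {c : Cell} (hW : ∀ d ∈ W, d.2 ≤ c.2) (hc : c ∈ W) (hL : L c ∉ W) :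
    UL c ∉ W ∧ #(nbrs (UL c) ∩ W) = 1 := by
  refine ⟨fun h => by have := hW _ h; simp at this, ?_⟩
  have e : nbrs (UL c) ∩ W = {c} := by
    refine Subset.antisymm ?_ ?_
    · intro d hd
      have := contacts_ul_subset_of_rows_le hW hd
      simp only [mem_insert, mem_singleton] at this ⊢
      rcases this with rfl | rfl
      · exact absurd (mem_inter.1 hd).2 hL
      · rfl
    · intro d hd
      simp only [mem_singleton] at hd; subst hd
      obtain ⟨a, b⟩ := d
      exact mem_inter.2 ⟨by simp [mem_nbrs_iff, UL], hc⟩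
  rw [e, card_singleton]

/-- Rows of the roofed set: everything on rows `≤ t.y`. [cite: MadrasSlade1993, §3.2 (proof of Theorem 3.2.3)] -/
theorem rows_le_union_roof {S : Finset Cell} {t : Cell} (h : IsLexmax S t) (k : ℕ) : ∀ d ∈ S ∪ roof t k, d.2 ≤ t.2 := by
  intro d hd
  rcases mem_union.1 hd with hd | hd
  · rcases h.2 d hd with h1 | ⟨h1, -⟩
    · exact h1.le
    · exact h1.le
  · obtain ⟨i, -, rfl⟩ := mem_roof.1 hd; simp

/-- ★ **RU-family FLIP is `+2`**: `B = B₀ + a_{k−1}` (spike at the roof end; `k ≥ 2`, `e_k ∉ B₀`), `c` a hexagon on the top row of `B₀` with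
`L c ∈ B₀`: `perim (B + UL c) = perim B + 2`. [cite: MadrasSlade1993, §3.2, Theorem 3.2.3 (3.2.3) and its proof, transplanted to `ℍ`] -/
theorem perim_chainFlip {B₀ : Finset Cell} {t₀ c : Cell} (h : IsLexmax B₀ t₀) (k : ℕ)
    (hc : c ∈ B₀) (hrow : c.2 = t₀.2) (hL : L c ∈ B₀) :
    perim (insert (UL c) (insert (roofCell t₀ (k - 1)) B₀)) = perim (insert (roofCell t₀ (k - 1)) B₀) + 2 := by
  classical
  have hW : ∀ d ∈ insert (roofCell t₀ (k - 1)) B₀, d.2 ≤ c.2 := by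
    intro d hd
    rcases mem_insert.1 hd with rfl | hd
    · simp [hrow]
    · rw [hrow]; rcases h.2 d hd with h1 | ⟨h1, -⟩
      · exact h1.le
      · exact h1.le
  obtain ⟨hnot, h2⟩ := card_contacts_ul_topRow_two hW (mem_insert_of_mem hc) (mem_insert_of_mem hL)
  exact perim_insert_of_contacts_eq_two hnot h2

/-- ★ **RU-family LEAF is `+2`**: `B = B₀ + a_{k−1}` as above, `c` a hexagon on the top row of `B₀` with `L c ∉ B₀`:
`perim (B₀ ∪ roof t₀ k + UL c) = perim B + 2`. [cite: MadrasSlade1993, §3.2, Theorem 3.2.3 (3.2.3) and its proof, transplanted to `ℍ`] -/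
theorem perim_chainLeaf {B₀ : Finset Cell} {t₀ c : Cell} (h : IsLexmax B₀ t₀) {k : ℕ} (hk : 2 ≤ k)
    (hrun : ∀ i < k, runCell t₀ i ∈ B₀) (hend : runCell t₀ k ∉ B₀) (hc : c ∈ B₀) (hrow : c.2 = t₀.2) (hL : L c ∉ B₀) :
    perim (insert (UL c) (B₀ ∪ roof t₀ k)) = perim (insert (roofCell t₀ (k - 1)) B₀) + 2 := by
  classical
  have hW : ∀ d ∈ B₀ ∪ roof t₀ k, d.2 ≤ c.2 := by rw [hrow]; exact rows_le_union_roof h k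
  have hL' : L c ∉ B₀ ∪ roof t₀ k := by
    rw [mem_union, not_or]
    refine ⟨hL, fun hm => ?_⟩
    obtain ⟨i, -, ei⟩ := mem_roof.1 hm
    -- roof cells are right of `t₀`; `L c` is left of `c ≤ t₀`
    have hx := congrArg Prod.fst ei
    have hcx : c.1 ≤ t₀.1 := by rcases h.2 c hc with h1 | ⟨-, h1⟩ <;> omega
    simp only [roofCell_fst, L_fst] at hx; omega
  obtain ⟨hnot, h1⟩ := card_contacts_ul_topRow_one hW (mem_union_left _ hc) hL'
  obtain ⟨hsp, hsp1⟩ := card_contacts_roofCell_last h hk hrun hend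
  rw [perim_insert_of_contacts_eq_one hnot h1, perim_union_roof_of_isLexmax h (by omega) hrun hend,
    perim_insert_of_contacts_eq_one hsp hsp1]

end HexCell

end Literature.Probability.RandomPlanarGeometry.SAW
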